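import Mathlib
import Literature.Computability.AlgebraicComplexity.SimultaneousDoubleProduct
import Summits.MatrixMultiplication.MatrixMultiplication.Theses.FourierTwoFamiliesModP

/-!
# Sketch — first lemmas of three crux ideas for `PrimeCyclicPowerGain` (stmt-MatrixMultiplication-14309)

Planner crux-ideate, ideator 3, round 1.  Signatures only (`sorry` bodies); they must elaborate.
`IsSDPP A B` is the tree's (W) ∧ (X) (`isSDPP_iff` is `Iff.rfl` with the clauses inlined in the
route file).
-/

open Finset
open scoped BigOperators Pointwise

namespace Summit.MatrixMultiplication.MatrixMultiplication.Cruxes.PrimeCyclicPowerGain.Sketch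

open Literature.Computability.AlgebraicComplexity

variable {p : ℕ} {n : ℕ}

/-- `R_{ij}(t)`: the number of representations `t = a + b`, `a ∈ A i`, `b ∈ B j`
(the `(i,j)` entry of the link matrix `M_t`). -/
def repCount (A B : Fin n → Finset (ZMod p)) (i j : Fin n) (t : ZMod p) : ℕ :=
  ((A i ×ˢ B j).filter fun x => x.1 + x.2 = t).card

/-- Idea `link-matrix-trichotomy`, first lemma (LINK MASS ACCOUNTING).  For an SDPP family the link
digraph at every point `t` is loops ⊔ isolated 2-cycles ⊔ (pure sources → pure sinks); an
off-diagonal link `(i,j)` at `t` that is not half of a 2-cycle ends in a pure sink `j`, i.e.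
`t ∉ A j + B k` for every `k`.  Counting the off-diagonal representation mass `(n² - n)s²` through
this shape, with at most `n` ordered 2-cycle links per point each truncated at weight `K`:
`(n² − n)·s² ≤ K·n·p + Σ_t Σ_{i≠j} (R_ij(t) − K)⁺ + Σ_t Σ_{i≠j} R_ij(t)·[t ∉ A_j + B]`.
(ℕ-subtraction is the positive part.) -/
theorem linkMassAccounting (hp : p.Prime) (s K : ℕ) (A B : Fin n → Finset (ZMod p))
    (hs : ∀ i : Fin n, (A i).card = s ∧ (B i).card = s) (h : IsSDPP A B) :
    haveI : Fact p.Prime := ⟨hp⟩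
    (n ^ 2 - n) * s ^ 2 ≤ K * n * p
      + ∑ t : ZMod p, ∑ i : Fin n, ∑ j : Fin n, (if i = j then 0 else (repCount A B i j t - K))
      + ∑ t : ZMod p, ∑ i : Fin n, ∑ j : Fin n,
          (if i ≠ j ∧ (∀ k : Fin n, t ∉ A j + B k) then repCount A B i j t else 0) := by
  sorry

/-- Idea `popular-difference-transversals`, first lemma (TRANSVERSAL PACKING).  If `d` is a matched
difference of the pairs `i ∈ I` — `a i ∈ A i` and `a i - d ∈ B i` — then the transversal
`P_d = {a i : i ∈ I}` has all its nonzero differences OUTSIDE `𝒟 - d`, where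
`𝒟 = ⋃_j (A j - B j)` is the matched-difference set; hence `P_d + Y` is a direct sum for every `Y`
whose nonzero differences lie INSIDE `𝒟 - d`, and `|I|·|Y| ≤ p`. -/
theorem transversalPacking (hp : p.Prime) (A B : Fin n → Finset (ZMod p)) (h : IsSDPP A B)
    (d : ZMod p) (I : Finset (Fin n)) (a : Fin n → ZMod p)
    (ha : ∀ i ∈ I, a i ∈ A i ∧ a i - d ∈ B i)
    (Y : Finset (ZMod p))
    (hY : ∀ y ∈ Y, ∀ y' ∈ Y, y ≠ y' → ∃ j : Fin n, ∃ u ∈ A j, ∃ v ∈ B j, y - y' = (u - v) - d) :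
    haveI : Fact p.Prime := ⟨hp⟩
    I.card * Y.card ≤ p := by
  sorry

/-- Idea `freiman-model-slice-rank`, first lemma (BOUNDED-TORSION FULL-SCALE GAIN).  In a host
`(ℤ/q)^m` of bounded exponent the tree's slice-rank chain (CKSU two-families → STPP in `H³` on a
Behrend corner-free index set, BCCGNSU Thm 3.3 → border tricolored sum-free set of size `≥ N s⁴/3`,
Lemma 3.4 tensor power, Thm A) gives a POWER saving for balanced SDPP families at full scale:
`n^{2-η} s⁴ ≤ C · (q^m)^{3(1-δ_q)}`.  The idea transplants this to `ℤ/p` through Freiman models of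
the structured branch. -/
theorem boundedTorsionFullScaleGain (q : ℕ) (hq : 2 ≤ q) :
    ∃ δ : ℝ, 0 < δ ∧ ∀ η : ℝ, 0 < η → ∃ C : ℝ, 0 < C ∧
      ∀ (m n s : ℕ) (A B : Fin n → Finset (Fin m → ZMod q)),
        (∀ i : Fin n, (A i).card = s ∧ (B i).card = s) → IsSDPP A B →
          (n : ℝ) ^ (2 - η) * (s : ℝ) ^ 4 ≤ C * ((q : ℝ) ^ m) ^ (3 * (1 - δ)) := by
  sorry

/-- Sanity: the crux decl is in scope under its route name (the ideas must conclude THIS). -/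
example : Prop := Summit.MatrixMultiplication.MatrixMultiplication.Theses.FourierTwoFamiliesModP.PrimeCyclicPowerGain

end Summit.MatrixMultiplication.MatrixMultiplication.Cruxes.PrimeCyclicPowerGain.Sketch
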